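import Summits.BirchSwinnertonDyer.BirchSwinnertonDyer.Theorems.ManinLocalTwoThreeNeronFLineOrder
import Summits.BirchSwinnertonDyer.Rank1Residual.ManinAdditive.ConwayCut
import Summits.BirchSwinnertonDyer.Rank1Residual.ManinAdditive.RamanujanCut
import Summits.BirchSwinnertonDyer.Rank1Residual.ManinAdditive.NeronOmegaThree
import HarnessLib

/-!
# PROP 29.AO under the cell's GIVEN rows: `v_p(c) + v_p(s) + v_p(r) = v_p(deg φ)` from `Λ =ₚ X` and `f ∈ X`

Cell bsd-f2-manin, prover seat p3 g17 (sequel to `…NeronFLineOrder`, p744591).  Every GIVEN row of the cell has the shape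
«`Δ.Λ ≤ X` and every element of the E-blind lattice `X` has a prime-to-`p` multiple in `Δ.Λ`» (`IsConwayNeronAtTwo` with
`X = conwayStableLattice N`, `p = 2`; `IsRamanujanNeronAtThree` with `X = ramanujanStableLattice N`, `IsOmegaNeronAtThree` with
`X = omegaLatticeAtThree N`, `p = 3`).  Under such a row, `f ∈ X` (an E-blind, computable membership — e.g. imc's ENGINE 7 column
`f_in_LOM`, or `mem_omegaLatticeAtThree_of_fricke_eigen`) gives a prime-to-`p` multiple of `f` in `Λ`, hence (`padicVal_bookkeeping_of_coprime`)
the EXACT bookkeeping identity of imc's PROP 29.AO at `p` with the tree's `lieSaturationIndex` / `neronCongruenceNumber`, and the depth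
dictionary `NeronCongruenceDepthAt p ⟺ v_p(r) = v_p(deg φ)`.  Pure bookkeeping; BSD is not proved by this; Manin's conjecture is not proved.
-/

set_option autoImplicit false
set_option linter.dupNamespace false

namespace Summit.BirchSwinnertonDyer.BirchSwinnertonDyer.Theorems.ManinLocalTwoThree.NeronFLineBookkeeping

open scoped MatrixGroups ModularForm
open CongruenceSubgroup Literature.NumberTheory.EllipticCurves.ModularForms
open Summit.BirchSwinnertonDyer.Rank1Residual.ManinAdditive
open Summit.BirchSwinnertonDyer.Rank1Residual.ManinAdditive.ConwayCut
open Summit.BirchSwinnertonDyer.Rank1Residual.ManinAdditive.RamanujanCut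
open Summit.BirchSwinnertonDyer.Rank1Residual.ManinAdditive.NeronOmegaThree

variable {N : ℕ} [NeZero N] {W : WeierstrassCurve ℚ} [W.IsElliptic] {D : ModularParametrizationData W N}
  (Δ : NeronFLineDatum W D)

/-- **Generic GIVEN-row form of PROP 29.AO.**  If every element of a lattice `X ∋ f` has a prime-to-`p` multiple in `Λ`, then
`v_p(c) + v_p(s) + v_p(r) = v_p(deg φ)` and `NeronCongruenceDepthAt p ⟺ v_p(r) = v_p(deg φ)`. [folklore] -/
theorem padicVal_bookkeeping_of_givenRow {X : Submodule ℤ (CuspForm (Gamma0 N) 2)} (p : ℕ) [hp : Fact p.Prime]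
    (hX : ∀ g ∈ X, ∃ n : ℕ, ¬ p ∣ n ∧ (n : ℤ) • g ∈ Δ.Λ) (hf : D.f ∈ X) :
    padicValInt p D.maninConstant + padicValNat p Δ.lieSaturationIndex + padicValNat p Δ.neronCongruenceNumber =
        padicValNat p D.modularDegree ∧
      (Δ.NeronCongruenceDepthAt p ↔ padicValNat p Δ.neronCongruenceNumber = padicValNat p D.modularDegree) := by
  obtain ⟨n, hpn, hn⟩ := hX D.f hf
  have hn0 : (n : ℤ) ≠ 0 := by
    intro h0
    exact hpn (by rw [Int.natCast_eq_zero.mp h0]; exact dvd_zero p)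
  have hpn' : ¬ (p : ℤ) ∣ (n : ℤ) := fun h => hpn (Int.natCast_dvd_natCast.mp h)
  have h1 := padicVal_bookkeeping_of_coprime Δ hn hn0 p hpn'
  have h2 := depthAt_iff_padicValNat_eq_fLineOrder Δ hn hn0 p
  have hm := fLineOrder_dvd Δ hn
  have hm0 : padicValNat p (Nat.card (ℤ ⧸ Δ.Λ.comap (LinearMap.toSpanSingleton ℤ (CuspForm (Gamma0 N) 2) D.f))) = 0 := by
    rw [padicValNat.eq_zero_iff]
    right; right
    intro hd
    exact hpn (by simpa using dvd_trans hd hm)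
  refine ⟨h1, ?_⟩
  rw [h2, hm0, zero_add]

/-- **At `p = 2` under desc's GIVEN row `IsConwayNeronAtTwo` with `f ∈ S^C(N)`**: `v₂(c) + v₂(s) + v₂(r) = v₂(deg φ)` and the depth
dictionary. [folklore] -/
theorem padicVal_bookkeeping_two_of_isConwayNeronAtTwo (hC : IsConwayNeronAtTwo Δ) (hf : D.f ∈ conwayStableLattice N) :
    padicValInt 2 D.maninConstant + padicValNat 2 Δ.lieSaturationIndex + padicValNat 2 Δ.neronCongruenceNumber =
        padicValNat 2 D.modularDegree ∧
      (Δ.NeronCongruenceDepthAt 2 ↔ padicValNat 2 Δ.neronCongruenceNumber = padicValNat 2 D.modularDegree) := by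
  haveI : Fact (Nat.Prime 2) := ⟨Nat.prime_two⟩
  refine padicVal_bookkeeping_of_givenRow Δ 2 (fun g hg => ?_) hf
  obtain ⟨n, hodd, hn⟩ := hC.2 g hg
  exact ⟨n, fun h2 => (Nat.not_even_iff_odd.mpr hodd) (even_iff_two_dvd.mpr h2), hn⟩

/-- **At `p = 3` under desc's GIVEN row `IsRamanujanNeronAtThree` with `f ∈ S^R(N)`**. [folklore] -/
theorem padicVal_bookkeeping_three_of_isRamanujanNeronAtThree (hR : IsRamanujanNeronAtThree Δ)
    (hf : D.f ∈ ramanujanStableLattice N) :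
    padicValInt 3 D.maninConstant + padicValNat 3 Δ.lieSaturationIndex + padicValNat 3 Δ.neronCongruenceNumber =
        padicValNat 3 D.modularDegree ∧
      (Δ.NeronCongruenceDepthAt 3 ↔ padicValNat 3 Δ.neronCongruenceNumber = padicValNat 3 D.modularDegree) := by
  haveI : Fact (Nat.Prime 3) := ⟨Nat.prime_three⟩
  exact padicVal_bookkeeping_of_givenRow Δ 3 hR.2 hf

/-- **At `p = 3` under imc's GIVEN row `IsOmegaNeronAtThree` (E-imc-150) with `f ∈ Ω₃(N)`** (e.g. by `mem_omegaLatticeAtThree_of_fricke_eigen`).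
[folklore] -/
theorem padicVal_bookkeeping_three_of_isOmegaNeronAtThree (hΩ : IsOmegaNeronAtThree Δ)
    (hf : D.f ∈ omegaLatticeAtThree N) :
    padicValInt 3 D.maninConstant + padicValNat 3 Δ.lieSaturationIndex + padicValNat 3 Δ.neronCongruenceNumber =
        padicValNat 3 D.modularDegree ∧
      (Δ.NeronCongruenceDepthAt 3 ↔ padicValNat 3 Δ.neronCongruenceNumber = padicValNat 3 D.modularDegree) := by
  haveI : Fact (Nat.Prime 3) := ⟨Nat.prime_three⟩
  exact padicVal_bookkeeping_of_givenRow Δ 3 hΩ.2 hf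

end Summit.BirchSwinnertonDyer.BirchSwinnertonDyer.Theorems.ManinLocalTwoThree.NeronFLineBookkeeping
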